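import Summits.ResolutionOfSingularities.ResolutionOfSingularities.Theorems.HomologicalConductorNoZenoRFirstKindContracted
import Summits.ResolutionOfSingularities.ResolutionOfSingularities.Theorems.HomologicalConductorNoZenoExcDegreeAvoids
import Literature.AlgebraicGeometry.Resolution.Lipman1969IntersectionPositivityHolds
import Literature.AlgebraicGeometry.Motives.CartierDivisorCurveDegree
import HarnessLib

/-!
# Crux `NoZenoR` (stmt-ResolutionOfSingularities-19943) — the EQUALITY CASE of anti-nefness: `(Z·E_η) = 0` for the
# cycle `Z` of a base ideal `𝔞𝒪_X` iff ONE element `c ∈ 𝔞` generates `𝔞𝒪_X` at EVERY point of `E_η`; hence over a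
# non-regular rational `S` every first-kind curve lies in one chart `X_c = {𝔪𝒪_X = (c)}`, `c ∈ 𝔪`

Route `ResolutionOfSingularities/HomologicalConductor` (cell decomp-res, hand leafhand-res-homologicalconduct-24 g0).
OURS: AI-written proof over tree theorems, weaker than expert review; nothing here is a statement of the manuscript
under review (Hironaka 2017).  SUPPORT level, counted 0.  Def-free, fact-free ((13.1) c) is the tree theorem
`Lipman1969_13_1_c_holds`).

* `exists_forall_mem_nonvanishing_of_excCurveDegree_eq_zero` — for a desingularization `π : X → Spec T` (any local
  `T`), an ideal `𝔞` whose base ideal sheaf `𝔞𝒪_X` is an effective Cartier divisor with cycle `Z`, and an integral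
  exceptional curve `E_η` with `(Z·E_η) = 0`: some `c ∈ 𝔞` has `E_η = cl{η} ⊆ X_c`, the non-vanishing locus of the
  global section `c` of `𝒪_X(−Z)` (at `η` some `c ∈ 𝔞` generates, tree `ExcCount.exists_mem_nonvanishing_neg_baseIdealDivisor`;
  `−Z + div(c)` is effective, avoids `η` and has degree `−(Z·E_η) = 0` on `E_η`, so by (13.1) c) it avoids every
  point of `cl{η}`);
* **`exists_forall_mem_nonvanishing_of_firstKind`** — `S` rational non-regular, `E_η` of the first kind ⇒ some
  `c ∈ 𝔪` generates `𝔪𝒪_X` at every point of `cl{η}` (with `excCurveDegree_baseIdeal_eq_zero_of_firstKind'`).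

Road (MEMO-19943-hand24g0-M0-ROAD.md, step [G]): `cl{η} ⊆ X_c` ⇒ the domination `σ : X → Bl_𝔪 Spec S` maps `cl{η}`
into the affine chart `D₊(ct)` (tree `IsBlowup.mem_range_chart_of_stalkIdeal_eq_span`, after transporting «`c`
generates» down the local stalk maps), and a morphism from the integral proper curve `E_η` to an affine scheme is
constant — so `σ(η)` is a CLOSED point of the quadratic transform.  No crux or summit statement is proved here.
-/

noncomputable section

-- single-problem summit: the doubled namespace component `ResolutionOfSingularities` is forced
set_option linter.dupNamespace false

open CategoryTheory CategoryTheory.Limits AlgebraicGeometry TopologicalSpace IsLocalRing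
open Literature.AlgebraicGeometry Literature.AlgebraicGeometry.Resolution Literature.AlgebraicGeometry.Motives

namespace Summit.ResolutionOfSingularities.ResolutionOfSingularities.Theorems.NoZeno.FirstKind

section EqualityCase

variable {T : Type} [CommRing T] [IsNoetherianRing T] [IsLocalRing T]
  {X : Scheme.{0}} [IsIntegral X] [IsLocallyNoetherian X] (π : X ⟶ Spec (.of T))

/-- **Equality case of anti-nefness: `(Z·E_η) = 0` ⇒ one element of `𝔞` generates `𝔞𝒪_X` along all of `E_η`.**
For a desingularization `π : X → Spec T`, an ideal `𝔞 ⊆ T` whose base ideal sheaf `𝔞𝒪_X` is an effective Cartier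
divisor (cycle `Z`), and `η ∈ excCurvePoints π` with `(Z·E_η) = 0`: there is `c ∈ 𝔞` with
`cl{η} ⊆ X_c = (−Z).nonvanishing c`. [cite: Lipman1969, Proposition (13.1) c) (p. 223); Section 12, Remark 2 c) (p. 221)] -/
theorem exists_forall_mem_nonvanishing_of_excCurveDegree_eq_zero (hπ : IsResolution π) {𝔞 : Ideal T}
    (hJ : IsEffectiveCartier (Scheme.IdealSheafData.ofIdealTop (𝔞.map (Morphisms.algebraMapΓ π))))
    {η : X} (hη : η ∈ excCurvePoints π)
    (h0 : excCurveDegree π (CartierDivisor.ofIsEffectiveCartier _ hJ) η = 0) :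
    ∃ c ∈ 𝔞, ∀ x ∈ closure ({η} : Set X),
      x ∈ (-CartierDivisor.ofIsEffectiveCartier _ hJ).nonvanishing (baseToFunctionField π c) := by
  haveI : IsProper π := hπ.isProper
  have hX : Scheme.IsRegular X := hπ.isRegular
  obtain ⟨c, hc, hηc⟩ := ExcCount.exists_mem_nonvanishing_neg_baseIdealDivisor π hJ η
  refine ⟨c, hc, ?_⟩
  set D := CartierDivisor.ofIsEffectiveCartier _ hJ with hD
  have hs : (-D).IsSection (baseToFunctionField π c) := ExcCount.isSection_neg_baseIdealDivisor π hJ hc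
  obtain ⟨i, hi, hu⟩ := hηc
  have hs0 : baseToFunctionField π c ≠ 0 := by
    intro h
    have := hu.ne_zero
    rw [h, mul_zero] at this
    exact this rfl
  -- `−Z + div(c)` is effective, avoids `η`, and has degree `−(Z·E_η) = 0` on `E_η`
  have heff : (-D + CartierDivisor.principal _ hs0).IsEffective :=
    (CartierDivisor.isEffective_add_principal_iff (D := -D) hs0).mpr hs
  have hav : (-D + CartierDivisor.principal _ hs0).Avoids η :=
    (CartierDivisor.avoids_add_principal_iff (-D) hs0).mpr ⟨i, hi, hu⟩
  have hdeg : excCurveDegree π (-D + CartierDivisor.principal _ hs0) η = 0 := by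
    rw [excCurveDegree_add π hη, excCurveDegree_principal π hη hs0, add_zero, excCurveDegree_neg π hη, h0,
      neg_zero]
  -- (13.1) c): it avoids every point of `cl{η}`
  have hall := ((Lipman1969_13_1_c_holds T X π hπ.isProper hX _ heff η hη hav).2).1 hdeg
  intro x hx
  exact (CartierDivisor.avoids_add_principal_iff (-D) hs0).mp (hall x hx)

end EqualityCase

section FirstKind

variable {S : Type} [CommRing S] [IsNoetherianRing S] [IsLocalRing S] [IsDomain S] [IsIntegrallyClosed S]
  {X : Scheme.{0}} [IsIntegral X] [IsLocallyNoetherian X] (π : X ⟶ Spec (.of S))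

/-- **Every first-kind curve lies in ONE chart of `𝔪𝒪_X`.**  `S` a two-dimensional Noetherian local normal domain
with a rational singularity, NOT regular; `π : X → Spec S` a desingularization; `E_η` an integral exceptional curve of
the first kind.  Then some `c ∈ 𝔪` generates `𝔪𝒪_X = 𝒪_X(−Z)` at every point of `cl{η}`
(`cl{η} ⊆ (−Z).nonvanishing c`): `(Z·E_η) = 0` (`excCurveDegree_baseIdeal_eq_zero_of_firstKind'`) and the equality
case of anti-nefness. [cite: Lipman1969, Proposition (3.1) (p. 203); Proposition (13.1) c) (p. 223)] -/
theorem exists_forall_mem_nonvanishing_of_firstKind (hdim : ringKrullDim S = 2) (hrat : HasRationalSingularity S)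
    (hsing : ¬ IsRegularLocalRing S) (hπ : IsResolution π) {η : X} (hη : η ∈ excCurvePoints π)
    (hfk : h0 π (primeDivisorIdeal η ^ 2) = 3 * h0 π (primeDivisorIdeal η))
    (hJ : IsEffectiveCartier (Scheme.IdealSheafData.ofIdealTop ((maximalIdeal S).map
      (Morphisms.algebraMapΓ π)))) :
    ∃ c ∈ maximalIdeal S, ∀ x ∈ closure ({η} : Set X),
      x ∈ (-CartierDivisor.ofIsEffectiveCartier _ hJ).nonvanishing (baseToFunctionField π c) :=
  exists_forall_mem_nonvanishing_of_excCurveDegree_eq_zero π hπ hJ hη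
    (excCurveDegree_baseIdeal_eq_zero_of_firstKind' π hdim hrat hsing hπ hη hfk hJ)

end FirstKind

end Summit.ResolutionOfSingularities.ResolutionOfSingularities.Theorems.NoZeno.FirstKind

end
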